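import Mathlib
import Summits.RiemannHypothesis.RiemannHypothesis.Theses.WeilGroundState
import Summits.RiemannHypothesis.RiemannHypothesis.Theorems.WeilGroundStateArchimedeanWindowSimpleEven
import Summits.RiemannHypothesis.RiemannHypothesis.Theorems.WeilGroundStateGroundStateSimpleEvenCellTransfer
import HarnessLib

/-!
# Crux `GroundStateSimpleEven` (stmt-RiemannHypothesis-1526), line `parity-multiplicity-commutator`
# (v2): the first certified CELL — `WeilWindowSimpleEven a` for every `a ∈ [1/3, (log 2)/2]`

Support file (`--supports stmt-RiemannHypothesis-1526`) proving the registered sub-goal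
`stub_cellThirdLogTwoHalf` of the v2 skeleton: the window clause of the crux on the whole interval of
windows `[1/3, (log 2)/2]`, from the two certificates the tree already holds for item
stmt-RiemannHypothesis-1529 (`a = (log 2)/2`) and the cell-transfer theorem of this line.

* UPPER at `b = 1/3`: `ε(1/3) ≤ 3/200` (`weilGroundEnergy_third_le`).  The trial bump
  `h = (1 − 9x²)⁺` of `…ArchimedeanWindowSimpleEvenTrial*.lean` is supported in `[-1/3, 1/3]`, no
  prime power enters a window `a` with `2a ≤ log 2`, and the killing constant and the Dirichlet
  energy of `h` are the same at `a = 1/3` as at `a = (log 2)/2`; the form-domain Rayleigh-quotient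
  bound (`stub_formDomainPos`) with the certified numbers `‖h‖₂² = 16/45`, `P(h) ≤ 0.3973`,
  `𝓔(h) ≤ 0.4324 + (32/45)·1.5225`, `M ≥ 5.367` gives `ε(1/3) ≤ 3/200` verbatim as in `…Trial4.lean`.
* LOWER at `c = (log 2)/2`: every `L²`-normalised ODD window-`c` test function has `Re Q ≥ 1/20`
  (`re_weilQuadratic_ge_of_odd_log_two_half`: the kernel-checked gap certificate `weilGapCert`,
  `WeilGapCert.weilQuadratic_re_ge_of_checkG` with `weilGapCert_checkG`, odd branch).
* CELL: `3/200 < 1/20`, so `weilWindowSimpleEven_on_cell_of_le` gives `WeilWindowSimpleEven a` for all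
  `a ∈ [1/3, (log 2)/2]` (`weilWindowSimpleEven_of_mem_Icc_third`).

This extends the set of windows where the crux is proved from `(0, 1/100] ∪ {(log 2)/2}` (Suzuki
2026 Thm 1.4; item 1529) to `(0, 1/100] ∪ [1/3, (log 2)/2]`, and exercises the bounded-range re-cut
end to end with certificates already in the tree.

Mathlib + proved tree files only; no definitions, no named facts, no `sorry`.
-/

noncomputable section

open Set MeasureTheory Filter
open scoped Real Topology ComplexConjugate

namespace Summit.RiemannHypothesis.RiemannHypothesis.Theorems.GroundStateSimpleEven

open Literature.NumberTheory.LFunctions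
open Summit.RiemannHypothesis.RiemannHypothesis.Theses.WeilGroundState
open Summit.RiemannHypothesis.RiemannHypothesis.Theorems.WeilGroundState

-- `linter.dupNamespace` off: the mandated namespace `Summit.RiemannHypothesis.RiemannHypothesis.…`
-- (single-problem summit) repeats a component.
set_option linter.dupNamespace false

/-! ## UPPER: `ε(1/3) ≤ 3/200` by the parabolic bump -/

/-- No prime power enters the window `1/3`: `Λ(n) = 0` for `n ∈ weilPrimeIndex (1/3)`
(`log n < 2/3 < log 2` forces `n ≤ 1`). [folklore] -/
theorem vonMangoldt_eq_zero_of_mem_weilPrimeIndex_third {n : ℕ}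
    (hn : n ∈ weilPrimeIndex (1 / 3 : ℝ)) : (ArithmeticFunction.vonMangoldt n : ℝ) = 0 := by
  refine vonMangoldt_eq_zero_of_mem_weilPrimeIndex_log_two_half ?_
  rw [mem_weilPrimeIndex] at hn ⊢
  have := Real.log_two_gt_d9
  linarith

/-- The killing constant does not see the window below the first prime:
`M_{1/3} = M_{(log 2)/2}`. [folklore] -/
theorem weilMarkovConstant_third_eq :
    weilMarkovConstant (1 / 3 : ℝ) = weilMarkovConstant (Real.log 2 / 2) := by
  unfold weilMarkovConstant
  rw [Finset.sum_eq_zero fun n hn ↦ by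
      rw [vonMangoldt_eq_zero_of_mem_weilPrimeIndex_third hn]; simp,
    Finset.sum_eq_zero fun n hn ↦ by
      rw [vonMangoldt_eq_zero_of_mem_weilPrimeIndex_log_two_half hn]; simp]

/-- The Dirichlet energy of the bump does not see the window below the first prime:
`𝓔_{1/3}(h) = 𝓔_{(log 2)/2}(h)`. [folklore] -/
theorem weilDirichletEnergy_third_trialFun_eq :
    weilDirichletEnergy (1 / 3 : ℝ) trialFun = weilDirichletEnergy (Real.log 2 / 2) trialFun := by
  unfold weilDirichletEnergy
  rw [Finset.sum_eq_zero fun n hn ↦ by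
      rw [vonMangoldt_eq_zero_of_mem_weilPrimeIndex_third hn]; simp,
    Finset.sum_eq_zero fun n hn ↦ by
      rw [vonMangoldt_eq_zero_of_mem_weilPrimeIndex_log_two_half hn]; simp]

/-- **`ε(1/3) ≤ 3/200`.** The form-domain Rayleigh quotient of the bump `h = (1 − 9x²)⁺`
(supported in `[-1/3, 1/3]`) at the window `1/3`, with the certified numbers of
`…ArchimedeanWindowSimpleEvenTrial*.lean` (`‖h‖₂² = 16/45`, `P(h) ≤ 0.3973`,
`𝓔(h) ≤ 0.4324 + (32/45)·1.5225`, `M ≥ 5.367`) — the same computation as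
`weilGroundEnergy_log_two_half_le`, one window to the left. [folklore] -/
theorem weilGroundEnergy_third_le : weilGroundEnergy (1 / 3 : ℝ) ≤ 3 / 200 := by
  obtain ⟨hint, hE⟩ := weilDirichletEnergy_trialFun_le
  have ha : (0 : ℝ) < 1 / 3 := by norm_num
  have h := Summit.RiemannHypothesis.RiemannHypothesis.Theorems.WeilWindowFlowWindowLipschitz.stub_formDomainPos
    (1 / 3 : ℝ) ha trialFun memLp_trialFun
    (Eventually.of_forall fun x hx ↦ trialFun_eq_zero_of_not_mem hx) hint
  rw [integral_norm_sq_trialFun, weilMarkovConstant_third_eq, weilDirichletEnergy_third_trialFun_eq] at h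
  have hP := weilPoleForm_trialFun_le
  have hM := weilMarkovConstant_log_two_half_ge
  nlinarith

/-! ## LOWER: the odd sector at `(log 2)/2` lies above `1/20` -/

/-- **The odd sector of the archimedean window.** Every `L²`-normalised ODD test function on
`[-(log 2)/2, (log 2)/2]` has `Re Q ≥ 1/20` — the odd branch of the kernel-checked gap certificate
of item stmt-RiemannHypothesis-1529 (`WeilGapCert.weilQuadratic_re_ge_of_checkG`,
`weilGapCert_checkG`, `θ = 1/20`). [folklore] -/
theorem re_weilQuadratic_ge_of_odd_log_two_half {g : ℝ → ℂ} (hg : IsWeilTest g)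
    (hsupp : tsupport g ⊆ Icc (-(Real.log 2 / 2)) (Real.log 2 / 2))
    (hnorm : ∫ t, ‖g t‖ ^ 2 = (1 : ℝ)) (hodd : ∀ t, g (-t) = -g t) :
    (1 / 20 : ℝ) ≤ (weilQuadratic g).re := by
  have hθ := WeilGapCert.weilQuadratic_re_ge_of_checkG weilGapCert_checkG hg hsupp (Or.inl hodd)
  rw [hnorm, mul_one, show weilGapCert.theta = 1 / 20 from rfl] at hθ
  push_cast at hθ
  exact hθ

/-! ## CELL: the window clause on `[1/3, (log 2)/2]` -/

/-- **The crux on the cell `[1/3, (log 2)/2]`.** For every window `a` with `1/3 ≤ a ≤ (log 2)/2`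
the bottom of Weil's form on `[-a, a]` is simple, isolated and even (`WeilWindowSimpleEven a`):
`ε(1/3) ≤ 3/200 < 1/20 ≤` odd sector at `(log 2)/2`, both bounds transfer along the cell by
antitonicity, and the halving theorem of this line concludes
(`weilWindowSimpleEven_on_cell_of_le`). [folklore] -/
theorem weilWindowSimpleEven_of_mem_Icc_third {a : ℝ} (h₁ : 1 / 3 ≤ a) (h₂ : a ≤ Real.log 2 / 2) :
    WeilWindowSimpleEven a :=
  weilWindowSimpleEven_on_cell_of_le (b := 1 / 3) (c := Real.log 2 / 2) (U := 3 / 200) (L := 1 / 20)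
    (by norm_num) (by norm_num) weilGroundEnergy_third_le
    (fun _ hg hs hn hodd ↦ re_weilQuadratic_ge_of_odd_log_two_half hg hs hn hodd) h₁ h₂

end Summit.RiemannHypothesis.RiemannHypothesis.Theorems.GroundStateSimpleEven

namespace Summit.RiemannHypothesis.RiemannHypothesis.Theorems

open Literature.NumberTheory.LFunctions

set_option linter.dupNamespace false in
/-- **Registered sub-goal (CELL-1/3) of line `parity-multiplicity-commutator` (v2): the crux on the
windows `[1/3, (log 2)/2]`.** For every `a` with `1/3 ≤ a ≤ (log 2)/2`, `WeilWindowSimpleEven a`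
(`GroundStateSimpleEven.weilWindowSimpleEven_of_mem_Icc_third`: trial-bump upper bound at `1/3`,
odd-sector certificate of item 1529 at `(log 2)/2`, cell transfer). [folklore] -/
theorem stub_cellThirdLogTwoHalf :
    ∀ a : ℝ, 1 / 3 ≤ a → a ≤ Real.log 2 / 2 → WeilWindowSimpleEven a :=
  fun _ h₁ h₂ => GroundStateSimpleEven.weilWindowSimpleEven_of_mem_Icc_third h₁ h₂

end Summit.RiemannHypothesis.RiemannHypothesis.Theorems

end
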